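import Summits.QuantumFields.YangMills.Theorems.ColdStartUniversalityLatticeLangevinGroundStateGen
import Summits.QuantumFields.YangMills.Theorems.ColdStartUniversalityLatticeLangevinDynkinForward
import HarnessLib

/-!
# Route `ColdStartUniversality`, crux K_A1 `UniformColdStartMixing` (stmt-QuantumFields-24809), rung `stub_fixedCutoffMixing`:
# (Inv) wall, step C — Dynkin's formula for the inverse ground state along the `β' = 0` dynamics

Helper file (seat `ym-line-csu-p1`, g8).  For a `β' = 0` solution family `Y` of the SU(2) SZZ system (regular-flow clause), the
plaquette function `ψ̂` at coupling `β'` and the ground-state potential `V̂ = ½ 𝓛_0 ψ̂ + ⅛ Γ(ψ̂,ψ̂)`: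

  `E[e^{ψ̂/2}(Y^x_τ)] = e^{ψ̂(x)/2} + ∫₀^τ E[(V̂ e^{ψ̂/2})(Y^x_r)] dr`   (`integral_exp_half_psi_beta_zero`),

with the `dr`-integrand continuous in `r`: Dynkin's forward formula `dynkin_forward` at `β = 0` for the cut-off observable
`χ · e^{ψ̂/2}` and the identity `𝓛_0 e^{ψ̂/2} = V̂ e^{ψ̂/2}` (`generator_exp_half`).  Third input of the Duhamel/Grönwall proof of
SZZ Lemma 3.3 for all `β'`.  No definition, no sorry.  RECORD-rung R3 plumbing; nothing here bears on the mass gap.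
-/

set_option autoImplicit false

noncomputable section

namespace Summit.QuantumFields.YangMills.Theorems.ColdStartUniversality

open MeasureTheory Finset Metric Filter
open scoped BigOperators Topology NNReal
open Literature.Probability.Process Literature.MathematicalPhysics.QuantumFieldTheory
open Literature.MathematicalPhysics.QuantumLattice (fundamentalRep fundamentalLatticeRep)

variable {L : ℕ} [NeZero L]

/-- **Dynkin's formula for `e^{ψ̂/2}` along the `β' = 0` dynamics.**  See the module docstring. [folklore] -/
theorem integral_exp_half_psi_beta_zero (β' : ℝ)
    {Ω : Type} [MeasurableSpace Ω] {P : Measure Ω} [IsProbabilityMeasure P]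
    {W : ℝ≥0 → Ω → (Edge 3 L × NoiseIdx 2 → ℝ)} (hW : IsFlatBrownian W P)
    (Y : GaugeConfig 3 L (Matrix.specialUnitaryGroup (Fin 2) ℂ) → ℝ≥0 → Ω →
      GaugeConfig 3 L (Matrix.specialUnitaryGroup (Fin 2) ℂ))
    (hY : ∀ x, (∀ ω, Y x 0 ω = x) ∧
      (latticeLangevinDynamics (fundamentalLatticeRep 2) 0).IsSolution (fundamentalRep (Fin 2))
        hW.natFiltration P W (Y x))
    (hYm : ∀ i : ℝ≥0, Measurable[@Prod.instMeasurableSpace (Set.Iic i)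
        (GaugeConfig 3 L (Matrix.specialUnitaryGroup (Fin 2) ℂ) × Ω) inferInstance
        (@Prod.instMeasurableSpace (GaugeConfig 3 L (Matrix.specialUnitaryGroup (Fin 2) ℂ)) Ω inferInstance
          (hW.natFiltration i))]
      (fun q : Set.Iic i × (GaugeConfig 3 L (Matrix.specialUnitaryGroup (Fin 2) ℂ) × Ω) => Y q.2.1 q.1 q.2.2))
    (x : GaugeConfig 3 L (Matrix.specialUnitaryGroup (Fin 2) ℂ)) :
    let ψV : GaugeConfig 3 L (Matrix.specialUnitaryGroup (Fin 2) ℂ) → ℝ := fun V =>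
      β' * ∑ p : Plaquette 3 L, (rootedLoop (fun (e : Edge 3 L) (i j : Fin 2) =>
        ((((fundamentalRep (Fin 2) (V e) : Matrix (Fin 2) (Fin 2) ℂ) i j).re : ℝ) : ℂ) +
          ((((fundamentalRep (Fin 2) (V e) : Matrix (Fin 2) (Fin 2) ℂ) i j).im : ℝ) : ℂ) * Complex.I)
        (p.1, p.2.1.1) p.2.1.2 false).trace.re
    let Vh : GaugeConfig 3 L (Matrix.specialUnitaryGroup (Fin 2) ℂ) → ℝ := fun V =>
      (let x : (Edge 3 L × Fin 2 × Fin 2 × Bool) → ℝ := fun q =>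
          (fun z : ℂ => if q.2.2.2 then z.im else z.re)
            ((fundamentalRep (Fin 2) (V q.1) : Matrix (Fin 2) (Fin 2) ℂ) q.2.1 q.2.2.1)
       let b₀ : (Edge 3 L × Fin 2 × Fin 2 × Bool) → ℝ := fun q =>
          (fun z : ℂ => if q.2.2.2 then z.im else z.re) ((latticeLangevinDynamics (fundamentalLatticeRep 2) 0).drift
            (matrixConfig (fundamentalRep (Fin 2)) V) q.1 q.2.1 q.2.2.1)
       let σ : (Edge 3 L × Fin 2 × Fin 2 × Bool) → (Edge 3 L × NoiseIdx 2) → ℝ := fun q k =>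
          if k.1 = q.1 then (fun z : ℂ => if q.2.2.2 then z.im else z.re)
            ((latticeLangevinDynamics (fundamentalLatticeRep 2) 0).noise
              (matrixConfig (fundamentalRep (Fin 2)) V) q.1 k.2 q.2.1 q.2.2.1) else 0
       let ψ : ((Edge 3 L × Fin 2 × Fin 2 × Bool) → ℝ) → ℝ := fun y =>
          β' * ∑ p : Plaquette 3 L, (rootedLoop (fun (e : Edge 3 L) (i j : Fin 2) =>
            ((y (e, i, j, false) : ℝ) : ℂ) + ((y (e, i, j, true) : ℝ) : ℂ) * Complex.I) (p.1, p.2.1.1) p.2.1.2 false).trace.re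
       1 / 2 * (∑ i, fderiv ℝ ψ x (Pi.single i 1) * b₀ i +
            1 / 2 * ∑ i, ∑ j, fderiv ℝ (fun z => fderiv ℝ ψ z (Pi.single i 1)) x (Pi.single j 1) * ∑ n, σ i n * σ j n) +
          1 / 8 * ∑ i, ∑ j, fderiv ℝ ψ x (Pi.single i 1) * fderiv ℝ ψ x (Pi.single j 1) * ∑ n, σ i n * σ j n)
    Continuous (fun r : ℝ => ∫ ω, Vh (Y x r.toNNReal ω) * Real.exp ((1 / 2 : ℝ) * ψV (Y x r.toNNReal ω)) ∂P) ∧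
    ∀ τ : ℝ, 0 ≤ τ → ∫ ω, Real.exp ((1 / 2 : ℝ) * ψV (Y x τ.toNNReal ω)) ∂P =
      Real.exp ((1 / 2 : ℝ) * ψV x) +
        ∫ r in (0 : ℝ)..τ, ∫ ω, Vh (Y x r.toNNReal ω) * Real.exp ((1 / 2 : ℝ) * ψV (Y x r.toNNReal ω)) ∂P := by
  intro ψV Vh
  classical
  haveI := secondCountableTopology_su2
  haveI := borelSpace_config L
  -- ### the objects in flat coordinates
  set ψ : ((Edge 3 L × Fin 2 × Fin 2 × Bool) → ℝ) → ℝ := fun y =>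
      β' * ∑ p : Plaquette 3 L, (rootedLoop (fun (e : Edge 3 L) (i j : Fin 2) =>
        ((y (e, i, j, false) : ℝ) : ℂ) + ((y (e, i, j, true) : ℝ) : ℂ) * Complex.I) (p.1, p.2.1.1) p.2.1.2 false).trace.re
    with hψdef
  let χ : ContDiffBump (0 : (Edge 3 L × Fin 2 × Fin 2 × Bool) → ℝ) := ⟨2, 3, by norm_num, by norm_num⟩
  have hχ : (2 : ℝ) ≤ χ.rIn := le_rfl
  set f₀ : ((Edge 3 L × Fin 2 × Fin 2 × Bool) → ℝ) → ℝ := fun y => Real.exp ((1 / 2 : ℝ) * ψ y) with hf₀def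
  set f : ((Edge 3 L × Fin 2 × Fin 2 × Bool) → ℝ) → ℝ := fun y =>
      (χ : ((Edge 3 L × Fin 2 × Fin 2 × Bool) → ℝ) → ℝ) y * f₀ y with hfdef
  set coords : GaugeConfig 3 L (Matrix.specialUnitaryGroup (Fin 2) ℂ) → (Edge 3 L × Fin 2 × Fin 2 × Bool → ℝ) :=
    fun V q => (fun z : ℂ => if q.2.2.2 then z.im else z.re)
      ((fundamentalRep (Fin 2) (V q.1) : Matrix (Fin 2) (Fin 2) ℂ) q.2.1 q.2.2.1) with hcoords
  set gen : GaugeConfig 3 L (Matrix.specialUnitaryGroup (Fin 2) ℂ) → ℝ := fun V =>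
      (∑ i : Edge 3 L × Fin 2 × Fin 2 × Bool, fderiv ℝ f (coords V) (Pi.single i 1) *
          (fun z : ℂ => if i.2.2.2 then z.im else z.re)
            ((latticeLangevinDynamics (fundamentalLatticeRep 2) 0).drift
              (matrixConfig (fundamentalRep (Fin 2)) V) i.1 i.2.1 i.2.2.1) +
      1 / 2 * ∑ i : Edge 3 L × Fin 2 × Fin 2 × Bool, ∑ j : Edge 3 L × Fin 2 × Fin 2 × Bool,
        fderiv ℝ (fun z => fderiv ℝ f z (Pi.single i 1)) (coords V) (Pi.single j 1) *
          ∑ n : Edge 3 L × NoiseIdx 2,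
            (if n.1 = i.1 then (fun z : ℂ => if i.2.2.2 then z.im else z.re)
              ((latticeLangevinDynamics (fundamentalLatticeRep 2) 0).noise
                (matrixConfig (fundamentalRep (Fin 2)) V) i.1 n.2 i.2.1 i.2.2.1) else 0) *
            (if n.1 = j.1 then (fun z : ℂ => if j.2.2.2 then z.im else z.re)
              ((latticeLangevinDynamics (fundamentalLatticeRep 2) 0).noise
                (matrixConfig (fundamentalRep (Fin 2)) V) j.1 n.2 j.2.1 j.2.2.1) else 0)) with hgendef
  -- smoothness and support
  have hψ3 : ContDiff ℝ 3 ψ := contDiff_psiHat (d := 3) (L := L) (N := 2) (n := 3) β'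
  have hψ2 : ContDiff ℝ 2 ψ := contDiff_psiHat (d := 3) (L := L) (N := 2) (n := 2) β'
  have hf₀3 : ContDiff ℝ 3 f₀ := Real.contDiff_exp.comp (contDiff_const.mul hψ3)
  have hf3 : ContDiff ℝ 3 f := (χ.contDiff (n := 3)).mul hf₀3
  have hfc : HasCompactSupport f := by rw [hfdef]; exact χ.hasCompactSupport.mul_right
  -- values at group points
  have hball : ∀ V : GaugeConfig 3 L (Matrix.specialUnitaryGroup (Fin 2) ℂ),
      coords V ∈ ball (0 : (Edge 3 L × Fin 2 × Fin 2 × Bool) → ℝ) 2 := by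
    intro V
    rw [mem_ball, dist_zero_right]
    exact (norm_coords_le_one V).trans_lt (by norm_num)
  have hψV : ∀ V : GaugeConfig 3 L (Matrix.specialUnitaryGroup (Fin 2) ℂ), ψV V = ψ (coords V) := fun V => rfl
  have hfeq : ∀ y ∈ ball (0 : (Edge 3 L × Fin 2 × Fin 2 × Bool) → ℝ) 2, f y = f₀ y := by
    intro y hy
    have h1 : (χ : ((Edge 3 L × Fin 2 × Fin 2 × Bool) → ℝ) → ℝ) y = 1 :=
      χ.one_of_mem_closedBall (by rw [mem_closedBall, dist_zero_right]; exact (le_of_lt (by simpa using hy)) |>.trans hχ)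
    simp only [hfdef, h1, one_mul]
  have hfval : ∀ V : GaugeConfig 3 L (Matrix.specialUnitaryGroup (Fin 2) ℂ), f (coords V) =
      Real.exp ((1 / 2 : ℝ) * ψV V) := fun V => by rw [hfeq _ (hball V), hf₀def, hψV]
  -- the generator at group points: the cut-off is invisible, then `generator_exp_half`
  have hgen : ∀ V : GaugeConfig 3 L (Matrix.specialUnitaryGroup (Fin 2) ℂ), gen V =
      Vh V * Real.exp ((1 / 2 : ℝ) * ψV V) := by
    intro V
    have hfev : ∀ y ∈ ball (0 : (Edge 3 L × Fin 2 × Fin 2 × Bool) → ℝ) 2, f =ᶠ[𝓝 y] f₀ := fun y hy =>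
      Filter.eventually_of_mem (isOpen_ball.mem_nhds hy) hfeq
    have hC1 : fderiv ℝ f (coords V) = fderiv ℝ f₀ (coords V) := (hfev _ (hball V)).fderiv_eq
    have hC2 : ∀ v, fderiv ℝ (fun z => fderiv ℝ f z v) (coords V) = fderiv ℝ (fun z => fderiv ℝ f₀ z v) (coords V) := by
      intro v
      refine Filter.EventuallyEq.fderiv_eq ?_
      filter_upwards [isOpen_ball.mem_nhds (hball V)] with z hz
      rw [(hfev z hz).fderiv_eq]
    rw [hgendef]
    dsimp only
    simp_rw [hC1, hC2]
    rw [hf₀def, generator_exp_half (fun i => (Pi.single i 1 : Edge 3 L × Fin 2 × Fin 2 × Bool → ℝ)) _ _ hψ2 (coords V),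
      hψV]
  -- Dynkin's forward formula
  obtain ⟨-, hcontg, hDyn⟩ := dynkin_forward (L := L) 0 hW Y hY hYm x hf3 hfc
  refine ⟨?_, fun τ hτ => ?_⟩
  · have h1 : Continuous (fun r : ℝ => ∫ ω, gen (Y x r.toNNReal ω) ∂P) := hcontg
    have h2 : (fun r : ℝ => ∫ ω, gen (Y x r.toNNReal ω) ∂P) =
        fun r : ℝ => ∫ ω, Vh (Y x r.toNNReal ω) * Real.exp ((1 / 2 : ℝ) * ψV (Y x r.toNNReal ω)) ∂P :=
      funext fun r => integral_congr_ae (Eventually.of_forall fun ω => hgen _)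
    rw [h2] at h1
    exact h1
  · have h := hDyn τ hτ
    have hL : ∫ ω, f (coords (Y x τ.toNNReal ω)) ∂P = ∫ ω, Real.exp ((1 / 2 : ℝ) * ψV (Y x τ.toNNReal ω)) ∂P :=
      integral_congr_ae (Eventually.of_forall fun ω => hfval _)
    have hI : ∫ r in (0 : ℝ)..τ, ∫ ω, gen (Y x r.toNNReal ω) ∂P =
        ∫ r in (0 : ℝ)..τ, ∫ ω, Vh (Y x r.toNNReal ω) * Real.exp ((1 / 2 : ℝ) * ψV (Y x r.toNNReal ω)) ∂P :=
      intervalIntegral.integral_congr fun r _ => integral_congr_ae (Eventually.of_forall fun ω => hgen _)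
    rw [hL, hfval x, hI] at h
    exact h

end Summit.QuantumFields.YangMills.Theorems.ColdStartUniversality

end
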